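import Mathlib
import Summits.Parity.BatemanHorn.Theorems.IsogenyRedeiPolyMobiusTailStubSignedTypeIOfKernel

/-!
# Crux `PolyMobiusTail` (stmt-Parity-0870), line `Sketch` (natural form): stub `stub_strip_core`

Swap and period with the EXACT root-count error, for every subset `T ⊆ Fin k`.  Beyond a threshold
`N₀ ≥ 3` past which all values `fᵢ(n)` are `≥ 2` and non-decreasing, for `x ≥ N₀` and `y ≥ 1` the
weighted Type-I sum
`𝒰_T(x,y) = Σ_{N₀≤n≤x} (∏_{i∈T} log fᵢ(n)) · Σ_{dᵢ ∣ fᵢ(n), ∏dᵢ ≤ y} (∏ μ(dᵢ)) ∏_{i∉T} log dᵢ`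
equals `(Σ_{N₀≤n≤x} ∏_{i∈T} log fᵢ(n)) · V_T(y)` up to
`C (log x)^{|T|} (1 + log y)^{k-|T|} Σ_{d ∈ [1,⌊y⌋]^k, ∏dᵢ ≤ y} μ²(d) #{r < ∏dᵢ : dᵢ ∣ fᵢ(r) ∀ i}`.

Proof: for `n ≥ N₀` the divisor tuples with `∏ dᵢ ≤ y` live in the fixed box `[1, ⌊y⌋]^k`
(`signedTypeI_divisor_sum_eq`); swapping the sums, the pattern `dᵢ ∣ fᵢ(n)` is `∏dᵢ`-periodic
(`signedTypeI_periodic`) and the weight `W(n) = ∏_{i∈T} log fᵢ(n)` is non-negative and monotone, so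
`SignedTypeIAux.core_estimate` gives the main term with error `4 W(x) Σ_d |w d| ρ_d`; finally
`W(x) ≤ (K log x)^{|T|}` (`signedTypeI_log_toNat_eval_le`) and
`|w d| = (∏ |μ(dᵢ)|) ∏_{i∉T} |log dᵢ| ≤ (∏ |μ(dᵢ)|) (1 + log y)^{k-|T|}` on the box.

Registered stub of the lead's skeleton `Summits/Parity/BatemanHorn/Cruxes/PolyMobiusTail/Lines/Sketch.lean`;
the statement below is the registered signature VERBATIM and must not be edited.
-/

open scoped BigOperators
open Filter Finset Polynomial Asymptotics

namespace Summit.Parity.BatemanHorn.Theorems.PolyMobiusTail.NaturalForm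

open Literature.NumberTheory.Sieve
open SignedTypeIAux

/-- The coefficients `w(d) = (∏ μ(dᵢ)) ∏_{i ∉ T} log dᵢ` satisfy
`|w d| ≤ (∏ |μ(dᵢ)|) (1 + log y)^{#(univ ∖ T)}` on the box `[1, ⌊y⌋]^k` (keeping the Möbius factor
and the exact number of logarithms). [folklore] -/
theorem stripCore_coeff_abs_le {k : ℕ} (T : Finset (Fin k)) {y : ℝ} (hy : 1 ≤ y)
    (d : Fin k → ℕ) (hd : d ∈ Fintype.piFinset (fun _ : Fin k => Icc 1 ⌊y⌋₊)) :
    |(∏ i, (ArithmeticFunction.moebius (d i) : ℝ)) * ∏ i ∈ univ \ T, Real.log (d i)|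
      ≤ (∏ i, |(ArithmeticFunction.moebius (d i) : ℝ)|) * (1 + Real.log y) ^ (univ \ T).card := by
  have hd' : ∀ i, 1 ≤ d i ∧ d i ≤ ⌊y⌋₊ := fun i => mem_Icc.mp (Fintype.mem_piFinset.mp hd i)
  rw [abs_mul, Finset.abs_prod, Finset.abs_prod]
  refine mul_le_mul_of_nonneg_left ?_ (Finset.prod_nonneg fun i _ => abs_nonneg _)
  have hly : 0 ≤ Real.log y := Real.log_nonneg hy
  calc ∏ i ∈ univ \ T, |Real.log (d i)| ≤ ∏ i ∈ univ \ T, (1 + Real.log y) := by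
        refine Finset.prod_le_prod (fun i _ => abs_nonneg _) fun i _ => ?_
        have h1 : (1 : ℝ) ≤ d i := by exact_mod_cast (hd' i).1
        have h2 : (d i : ℝ) ≤ y := le_trans (by exact_mod_cast (hd' i).2) (Nat.floor_le (by linarith))
        rw [abs_of_nonneg (Real.log_nonneg h1)]
        linarith [Real.log_le_log (by linarith) h2]
    _ = (1 + Real.log y) ^ (univ \ T).card := Finset.prod_const _

/-- **Stub `stub_strip_core`.** Swap and period with the exact root-count error, for every `T ⊆ Fin k`: beyond a threshold `N₀ ≥ 3` past which all values are `≥ 2` and non-decreasing, for `x ≥ N₀` and `y ≥ 1`, `Σ_{N₀≤n≤x} (∏_{i∈T} log fᵢ(n)) P_T(n,y) = (Σ_{N₀≤n≤x} ∏_{i∈T} log fᵢ(n)) · V_T(y) + O((log x)^{|T|} (1 + log y)^{k-|T|} Σ_{d ∈ box, ∏dᵢ ≤ y} μ²(d) #{r < ∏dᵢ : dᵢ ∣ fᵢ(r)})`. [folklore] -/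
theorem stub_strip_core : ∀ (k : ℕ) (f : Fin k → ℤ[X]) (T : Finset (Fin k)) (N₀ : ℕ), 3 ≤ N₀ →
    (∀ n : ℕ, N₀ ≤ n → ∀ i, 2 ≤ ((f i).eval (n : ℤ)).toNat) →
    (∀ i (m n : ℕ), N₀ ≤ m → m ≤ n → (f i).eval (m : ℤ) ≤ (f i).eval (n : ℤ)) →
    ∃ C : ℝ, ∀ x : ℕ, N₀ ≤ x → ∀ y : ℝ, 1 ≤ y →
      |(∑ n ∈ Finset.Icc N₀ x, (∏ i ∈ T, Real.log ((((f i).eval (n : ℤ)).toNat : ℝ))) *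
          ∑ d ∈ Fintype.piFinset (fun i => (((f i).eval (n : ℤ)).toNat).divisors),
            if ∏ i, (d i : ℝ) ≤ y then
              (∏ i, (ArithmeticFunction.moebius (d i) : ℝ)) * ∏ i ∈ Finset.univ \ T, Real.log (d i)
            else 0)
        - (∑ n ∈ Finset.Icc N₀ x, ∏ i ∈ T, Real.log ((((f i).eval (n : ℤ)).toNat : ℝ))) *
          ∑ d ∈ Fintype.piFinset (fun _ : Fin k => Finset.Icc 1 ⌊y⌋₊),
            if ∏ i, (d i : ℝ) ≤ y then
              (∏ i, (ArithmeticFunction.moebius (d i) : ℝ)) * (∏ i ∈ Finset.univ \ T, Real.log (d i)) *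
                ((((Finset.range (∏ i, d i)).filter
                    (fun n : ℕ => ∀ i, ((d i : ℕ) : ℤ) ∣ (f i).eval (n : ℤ))).card : ℝ) / ∏ i, (d i : ℝ))
            else 0|
      ≤ C * Real.log x ^ T.card * (1 + Real.log y) ^ (Finset.univ \ T).card *
          ∑ d ∈ Fintype.piFinset (fun _ : Fin k => Finset.Icc 1 ⌊y⌋₊),
            if ∏ i, (d i : ℝ) ≤ y then
              (∏ i, |(ArithmeticFunction.moebius (d i) : ℝ)|) *
                (((Finset.range (∏ i, d i)).filter
                    (fun n : ℕ => ∀ i, ((d i : ℕ) : ℤ) ∣ (f i).eval (n : ℤ))).card : ℝ)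
            else 0 := by
  intro k f T N₀ hN₀3 h2 hmono
  obtain ⟨K, hKlog⟩ := signedTypeI_log_toNat_eval_le f
  refine ⟨4 * (K : ℝ) ^ T.card, fun x hx y hy1 => ?_⟩
  set W : ℕ → ℝ := fun n => ∏ i ∈ T, Real.log ((((f i).eval (n : ℤ)).toNat : ℕ) : ℝ) with hW
  set w : (Fin k → ℕ) → ℝ := fun d =>
    (∏ i, (ArithmeticFunction.moebius (d i) : ℝ)) * ∏ i ∈ univ \ T, Real.log (d i) with hw
  set ρ : (Fin k → ℕ) → ℕ := fun d =>
    ((range (∏ i, d i)).filter (fun n : ℕ => ∀ i, ((d i : ℕ) : ℤ) ∣ (f i).eval (n : ℤ))).card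
    with hρ
  set R : ℝ := ∑ d ∈ Fintype.piFinset (fun _ : Fin k => Icc 1 ⌊y⌋₊),
    (if ∏ i, (d i : ℝ) ≤ y then |w d| * (ρ d : ℝ) else 0) with hR
  set R' : ℝ := ∑ d ∈ Fintype.piFinset (fun _ : Fin k => Icc 1 ⌊y⌋₊),
    (if ∏ i, (d i : ℝ) ≤ y then (∏ i, |(ArithmeticFunction.moebius (d i) : ℝ)|) * (ρ d : ℝ) else 0)
    with hR'
  have hWnn : ∀ n, 0 ≤ W n := fun n => Finset.prod_nonneg fun i _ => Real.log_natCast_nonneg _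
  have hWmono : ∀ m n, N₀ ≤ m → m ≤ n → W m ≤ W n := by
    intro m n hm hmn
    refine Finset.prod_le_prod (fun i _ => Real.log_natCast_nonneg _) fun i _ => ?_
    refine Real.log_le_log (by exact_mod_cast (by linarith [h2 m hm i])) ?_
    exact_mod_cast Int.toNat_le_toNat (hmono i m n hm hmn)
  have hx3 : 3 ≤ x := hN₀3.trans hx
  have hWx : W x ≤ ((K : ℝ) * Real.log x) ^ T.card := by
    refine (Finset.prod_le_prod (fun i _ => Real.log_natCast_nonneg _)
      fun i _ => hKlog x (by omega) i).trans_eq ?_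
    rw [Finset.prod_const]
  -- 1. for `n ≥ N₀` the inner sums live on the fixed box
  have hM : ∑ n ∈ Icc N₀ x, W n *
      ∑ d ∈ Fintype.piFinset (fun i => (((f i).eval (n : ℤ)).toNat).divisors),
        (if ∏ i, (d i : ℝ) ≤ y then w d else 0)
      = ∑ n ∈ Icc N₀ x, W n * ∑ d ∈ Fintype.piFinset (fun _ : Fin k => Icc 1 ⌊y⌋₊),
        if ∏ i, (d i : ℝ) ≤ y then
          w d * (if (∀ i, ((d i : ℕ) : ℤ) ∣ (f i).eval (n : ℤ)) then 1 else 0) else 0 := by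
    refine Finset.sum_congr rfl fun n hn => ?_
    rw [signedTypeI_divisor_sum_eq f w (fun i => ?_) y]
    have := h2 n (mem_Icc.mp hn).1 i
    omega
  change |∑ n ∈ Icc N₀ x, W n *
      ∑ d ∈ Fintype.piFinset (fun i => (((f i).eval (n : ℤ)).toNat).divisors),
        (if ∏ i, (d i : ℝ) ≤ y then w d else 0)
      - (∑ n ∈ Icc N₀ x, W n) * ∑ d ∈ Fintype.piFinset (fun _ : Fin k => Icc 1 ⌊y⌋₊),
        (if ∏ i, (d i : ℝ) ≤ y then w d * ((ρ d : ℝ) / ∏ i, (d i : ℝ)) else 0)|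
    ≤ 4 * (K : ℝ) ^ T.card * Real.log x ^ T.card * (1 + Real.log y) ^ (univ \ T).card * R'
  rw [hM]
  -- 2. swap the sums and use periodicity
  have hcore : |(∑ n ∈ Icc N₀ x, W n * ∑ d ∈ Fintype.piFinset (fun _ : Fin k => Icc 1 ⌊y⌋₊),
        if ∏ i, (d i : ℝ) ≤ y then
          w d * (if (∀ i, ((d i : ℕ) : ℤ) ∣ (f i).eval (n : ℤ)) then 1 else 0) else 0)
      - (∑ n ∈ Icc N₀ x, W n) * ∑ d ∈ Fintype.piFinset (fun _ : Fin k => Icc 1 ⌊y⌋₊),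
        (if ∏ i, (d i : ℝ) ≤ y then w d * ((ρ d : ℝ) / ∏ i, (d i : ℝ)) else 0)|
      ≤ 4 * W x * R :=
    core_estimate W w (fun d n => ∀ i, ((d i : ℕ) : ℤ) ∣ (f i).eval (n : ℤ)) hx y
      (fun n _ => hWnn n) hWmono (fun d n => signedTypeI_periodic f d n)
  refine hcore.trans ?_
  -- 3. the coefficient bound, termwise on the box
  have hR0 : 0 ≤ R := Finset.sum_nonneg fun d _ => by
    split_ifs
    · positivity
    · exact le_rfl
  have hRle : R ≤ (1 + Real.log y) ^ (univ \ T).card * R' := by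
    rw [hR, hR', Finset.mul_sum]
    refine Finset.sum_le_sum fun d hd => ?_
    split_ifs with hp
    · calc |w d| * (ρ d : ℝ)
          ≤ ((∏ i, |(ArithmeticFunction.moebius (d i) : ℝ)|) * (1 + Real.log y) ^ (univ \ T).card)
              * (ρ d : ℝ) :=
            mul_le_mul_of_nonneg_right (stripCore_coeff_abs_le T hy1 d hd) (Nat.cast_nonneg _)
        _ = (1 + Real.log y) ^ (univ \ T).card
              * ((∏ i, |(ArithmeticFunction.moebius (d i) : ℝ)|) * (ρ d : ℝ)) := by ring
    · simp
  -- 4. assemble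
  calc 4 * W x * R
      ≤ 4 * ((K : ℝ) * Real.log x) ^ T.card * ((1 + Real.log y) ^ (univ \ T).card * R') :=
        mul_le_mul (mul_le_mul_of_nonneg_left hWx (by norm_num)) hRle hR0 (by positivity)
    _ = 4 * (K : ℝ) ^ T.card * Real.log x ^ T.card * (1 + Real.log y) ^ (univ \ T).card * R' := by
        rw [mul_pow]; ring
  
end Summit.Parity.BatemanHorn.Theorems.PolyMobiusTail.NaturalForm
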